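import Mathlib
import Summits.Ventures.PercRepro2.ZMeanProof
import Summits.Ventures.PercRepro2.PendantRoot
import Summits.Ventures.PercRepro2.A3LeafQuadratic
import Summits.Ventures.PercRepro2.HMFLeaf
import Summits.Ventures.PercRepro2.HMFPendantBEvents
import Summits.Ventures.PercRepro2.HMFPendantB
import Summits.Ventures.PercRepro2.HMFLeafStep
import Summits.Ventures.PercRepro2.HMFLeafIso
import Summits.Ventures.PercRepro2.HMFLeafRB

/-!
# The attachment coefficient of the (HMF) leaf step in the Rao–Blackwell vocabulary
(blind cell PercRepro2, night-1 g7; NIGHT1-G7.md §1 (K′))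

`kappa_eq` (HMFLeafRB.lean) gives `κ = 4 HMFc(½) − 2 HMFc(1)` at a leaf `a₃` (edge `f = {a₃, y}`)
in the masses of the contracted instance `p[f ↦ 1]`.  Splitting `Q = PD ⊔ T ⊔ T′` there
(`CovForm.Qsplit`) the three coefficients become the coupling masses of `y`:
`Z − D¹ = P(T) + P(T′) = P(Q, y ∈ U)`, `A_L + A_H − D_o¹ = P(T ∪ T′, o ∈ U)`,
`B_H − W¹ = P(T, b ∈ C₁) + P(T′, b ∈ C₂)` (`b` on the side opposite to `y`), and the gap bracket is
`2 [P(T, o ∈ U) P(T′) − P(T′, o ∈ U) P(T)]`: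

  `κ = −2Z·P(T∪T′, oU)·[P(T, bL) + P(T′, bH)] + 2 P(T∪T′)·(A_L B_H + A_H B_L − Z X̂¹)
       + 2 (B_H − B_L)·[P(T, oU) P(T′) − P(T′, oU) P(T)]`        (K′)

so `κ ≥ 0` ((ATT-y)) is an upper bound on the contracted mean field `X̂¹` — in the cluster
language of row 2′RB: `Z²` times the Rao–Blackwell cross covariances of `(o, b)` along `C(y)` plus
the `T/T′` mean-field terms (NIGHT1-G7.md §2).
-/

namespace Summit.Ventures.PercRepro2

open UnionCluster CovForm PendantRoot HMFPendantRoot HMFPendantB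

namespace HMFLeafStep

variable {V : Type*} {E : Type*} [Fintype E] [DecidableEq E] [Fintype V] [DecidableEq V]
  {R : Type*} [Field R] [LinearOrder R] [IsStrictOrderedRing R]

variable (p : E → R) (ends : E → Sym2 V) {f : E} {a₃ y : V}

/-- **The closed form (K′) of `κ`** in the coupling masses of the attachment vertex on the
contracted instance `p[f ↦ 1]` (`T = {a₁ ∉ C₂, a₃ ∈ C₂}`, `T′` its mirror, all at `p[f ↦ 1]`). -/
theorem kappa_eq_split (hp : IsProbVec p) (hf : ends f = s(a₃, y))
    (hleaf : ∀ e, a₃ ∈ ends e → e = f) (h3y : a₃ ≠ y) {o a₁ a₂ b : V} (h31 : a₃ ≠ a₁) (h32 : a₃ ≠ a₂)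
    (ho : o ≠ a₃) (hb : b ≠ a₃) :
    4 * HMFc (Function.update p f (1 / 2)) ends o a₁ a₂ a₃ b -
        2 * HMFc (Function.update p f 1) ends o a₁ a₂ a₃ b =
      -2 * prob p (avoidAll ends a₂ {a₁}) *
          (prob (Function.update p f 1) (TEvent ends a₁ a₂ a₃ ∩ connEvent ends a₁ o) +
            prob (Function.update p f 1) (TEvent ends a₁ a₂ a₃ ∩ connEvent ends a₂ o) +
            prob (Function.update p f 1) (TEvent ends a₂ a₁ a₃ ∩ connEvent ends a₁ o) +
            prob (Function.update p f 1) (TEvent ends a₂ a₁ a₃ ∩ connEvent ends a₂ o)) *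
          (prob (Function.update p f 1) (TEvent ends a₁ a₂ a₃ ∩ connEvent ends a₁ b) +
            prob (Function.update p f 1) (TEvent ends a₂ a₁ a₃ ∩ connEvent ends a₂ b)) +
        2 * (prob (Function.update p f 1) (TEvent ends a₁ a₂ a₃) +
              prob (Function.update p f 1) (TEvent ends a₂ a₁ a₃)) *
          (prob p (avoidAll ends a₂ {a₁} ∩ connEvent ends a₁ o) *
                prob p (avoidAll ends a₂ {a₁} ∩ connEvent ends a₂ b) +
              prob p (avoidAll ends a₂ {a₁} ∩ connEvent ends a₂ o) *
                prob p (avoidAll ends a₂ {a₁} ∩ connEvent ends a₁ b) -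
            prob p (avoidAll ends a₂ {a₁}) * Xhat (Function.update p f 1) ends o a₁ a₂ a₃ b) +
        2 * (prob p (avoidAll ends a₂ {a₁} ∩ connEvent ends a₂ b) -
              prob p (avoidAll ends a₂ {a₁} ∩ connEvent ends a₁ b)) *
          ((prob (Function.update p f 1) (TEvent ends a₁ a₂ a₃ ∩ connEvent ends a₁ o) +
                prob (Function.update p f 1) (TEvent ends a₁ a₂ a₃ ∩ connEvent ends a₂ o)) *
              prob (Function.update p f 1) (TEvent ends a₂ a₁ a₃) -
            (prob (Function.update p f 1) (TEvent ends a₂ a₁ a₃ ∩ connEvent ends a₁ o) +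
                prob (Function.update p f 1) (TEvent ends a₂ a₁ a₃ ∩ connEvent ends a₂ o)) *
              prob (Function.update p f 1) (TEvent ends a₁ a₂ a₃)) := by
  set p1 := Function.update p f 1 with hp1
  have h13 : a₁ ≠ a₃ := Ne.symm h31
  have h23 : a₂ ≠ a₃ := Ne.symm h32
  have fc : ∀ {x z : V}, x ≠ a₃ → z ≠ a₃ → Free f (connEvent ends x z) :=
    fun hx hz => free_connEvent hf hleaf h3y hx hz
  have fQ : Free f (avoidAll ends a₂ {a₁}) := by
    rw [avoidAll_eq_compl]
    exact (fc h13 h23).compl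
  have c₁o := fc h13 ho
  have c₂o := fc h23 ho
  have c₁b := fc h13 hb
  have c₂b := fc h23 hb
  -- the `Q`-masses at `p1` are the `f`-free ones at `p`
  have hQ : prob p1 (avoidAll ends a₂ {a₁}) = prob p (avoidAll ends a₂ {a₁}) :=
    PendantEdm.prob_update_of_free p fQ 1
  have hQo₁ : prob p1 (avoidAll ends a₂ {a₁} ∩ connEvent ends a₁ o) =
      prob p (avoidAll ends a₂ {a₁} ∩ connEvent ends a₁ o) :=
    PendantEdm.prob_update_of_free p (fQ.inter c₁o) 1
  have hQo₂ : prob p1 (avoidAll ends a₂ {a₁} ∩ connEvent ends a₂ o) =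
      prob p (avoidAll ends a₂ {a₁} ∩ connEvent ends a₂ o) :=
    PendantEdm.prob_update_of_free p (fQ.inter c₂o) 1
  have hQb₂ : prob p1 (avoidAll ends a₂ {a₁} ∩ connEvent ends a₂ b) =
      prob p (avoidAll ends a₂ {a₁} ∩ connEvent ends a₂ b) :=
    PendantEdm.prob_update_of_free p (fQ.inter c₂b) 1
  -- the splits `Q = PD ⊔ T ⊔ T′` at `p1`
  have sU := Qsplit_univ p1 ends a₁ a₂ a₃
  have so₁ := Qsplit p1 ends a₁ a₂ a₃ (connEvent ends a₁ o)
  have so₂ := Qsplit p1 ends a₁ a₂ a₃ (connEvent ends a₂ o)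
  have sb₂ := Qsplit p1 ends a₁ a₂ a₃ (connEvent ends a₂ b)
  rw [hQ] at sU
  rw [hQo₁] at so₁
  rw [hQo₂] at so₂
  rw [hQb₂] at sb₂
  have key := kappa_eq p ends hp hf hleaf h3y h31 h32 ho hb
  rw [key]
  simp only [Do, massM2, deltaT, EQ3, EQ3o]
  rw [Set.inter_comm (connEvent ends a₂ b) (TEvent ends a₁ a₂ a₃),
    Set.inter_comm (connEvent ends a₁ b) (TEvent ends a₁ a₂ a₃)]
  linear_combination
    (2 * (prob p (avoidAll ends a₂ {a₁} ∩ connEvent ends a₁ o) *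
        prob p (avoidAll ends a₂ {a₁} ∩ connEvent ends a₂ b) +
      prob p (avoidAll ends a₂ {a₁} ∩ connEvent ends a₂ o) *
        prob p (avoidAll ends a₂ {a₁} ∩ connEvent ends a₁ b) -
      prob p (avoidAll ends a₂ {a₁}) * Xhat p1 ends o a₁ a₂ a₃ b) -
      (prob p (avoidAll ends a₂ {a₁} ∩ connEvent ends a₂ b) -
          prob p (avoidAll ends a₂ {a₁} ∩ connEvent ends a₁ b)) *
        (prob p1 (TEvent ends a₂ a₁ a₃ ∩ connEvent ends a₁ o) +
          prob p1 (TEvent ends a₂ a₁ a₃ ∩ connEvent ends a₂ o) -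
          prob p1 (TEvent ends a₁ a₂ a₃ ∩ connEvent ends a₁ o) -
          prob p1 (TEvent ends a₁ a₂ a₃ ∩ connEvent ends a₂ o))) * sU +
    (-2 * prob p (avoidAll ends a₂ {a₁}) *
        (prob p1 (TEvent ends a₁ a₂ a₃ ∩ connEvent ends a₁ b) +
          prob p1 (TEvent ends a₂ a₁ a₃ ∩ connEvent ends a₂ b)) +
      (prob p (avoidAll ends a₂ {a₁} ∩ connEvent ends a₂ b) -
          prob p (avoidAll ends a₂ {a₁} ∩ connEvent ends a₁ b)) *
        (prob p1 (TEvent ends a₂ a₁ a₃) - prob p1 (TEvent ends a₁ a₂ a₃))) * (so₁ + so₂) +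
    (-2 * prob p (avoidAll ends a₂ {a₁}) *
        (prob p (avoidAll ends a₂ {a₁} ∩ connEvent ends a₁ o) +
          prob p (avoidAll ends a₂ {a₁} ∩ connEvent ends a₂ o) -
          (prob p1 (PDEvent ends a₁ a₂ a₃ ∩ connEvent ends a₁ o) +
            prob p1 (PDEvent ends a₁ a₂ a₃ ∩ connEvent ends a₂ o)))) * sb₂

end HMFLeafStep

end Summit.Ventures.PercRepro2
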